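import Literature.Analysis.SingularIntegrals.CalderonZygmundWeakType
import Mathlib.MeasureTheory.Function.ContinuousMapDense
import Mathlib.MeasureTheory.Function.LpSeminorm.CompareExp
import Mathlib.MeasureTheory.Function.LpSpace.Complete
import Mathlib.MeasureTheory.Integral.MeanInequalities
import Mathlib.MeasureTheory.Measure.Haar.Unique
import HarnessLib

/-!
# The `L^p` inequalities for singular integrals, `1 < p < ∞` (Stein 1970, Ch. II §2.5, §3.1–3.2)

Analysis/SingularIntegrals file 4 of the Calderón–Zygmund `L^p` theory vendored for the discharge
of `Literature.Analysis.FluidPDE.stein1970_normalisedPressure_Lp_bound` (Stein 1970, Ch. II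
§4.2 Theorem 3). Everything here is PROVED.

**Stein 1970, Ch. II §2.2 Theorem 1 / §3.1 Corollary / §3.2 Theorem 2 (the `L^p` conclusion).**
*Let `Tf = K * f` with `‖Tf‖₂ ≤ A‖f‖₂` and `∫_{|x|≥2|y|} |K(x-y) - K(x)| dx ≤ B`. Then
`‖Tf‖_p ≤ A_p ‖f‖_p`, `1 < p < ∞`, where `A_p` depends only on `p`, `A`, `B` and the dimension
`n`* (§2.5: (a) `p = 2`; (b) `1 < p < 2` by the Marcinkiewicz interpolation theorem between the
weak type `(1,1)` of §2.4 and the type `(2,2)`; (c) `2 < p < ∞` by duality,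
`∫(Tf)φ = ∫ f (T̃φ)` with `T̃` the operator with kernel `K(-x)`, "the theorem is valid for
`1 < q < 2` with the kernel `K(-x)` … with the same constant `A_q`", and
`‖ψ‖_p = sup{|∫ψφ| : ‖φ‖_q ≤ 1}`).

## Rendering (design notes)

* Setting of file 3: `E` finite-dimensional real normed (`n = dim E ≥ 1`), additive Haar measure
  `μ`, kernel `k` measurable and bounded (qualitative), operator `x ↦ ∫ t, f t * k (x - t) ∂μ`,
  admissible class = bounded, compactly supported, measurable `f`.
* `eLpNorm_le_of_continuous` (density, Stein's "one can thus extend `T` … by continuity"): an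
  `L^p` bound on continuous compactly supported functions passes to the admissible class
  (approximate in `L^p` by `C_c` (Mathlib), clip to the sup bound and cut off near the support so
  that the approximation is also in `L¹`; the operator is `L¹ → L^∞` continuous; Fatou).
* `eLpNorm_le_of_lt_two`: `1 < p < 2` from files 1 and 3 (explicit constant).
* `eLpNorm_le_of_adjoint`: the duality step (c), with test functions
  `φ_R = 1_{B̄(0,R)} F|F|^{p-2}`, `F = Tf`, in the admissible class (no appeal to `(L^p)* = L^q`).
* `exists_eLpNorm_le` — **the theorem**: for every `n`, `A`, `B`, `1 < p < ∞` there is ONE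
  constant `C` such that for every `E` of dimension `n`, every `μ`, every such kernel with
  `L²`-constant `A` on `C_c` and Hörmander constant `B`, and every admissible `f`,
  `‖Tf‖_p ≤ C ‖f‖_p` (the uniformity "`A_p` depends only on `p, B, n`" that Stein uses to pass to
  truncated / regularised kernels, §3.2–3.4).

## Mathlib / tree

`MemLp.exists_hasCompactSupport_eLpNorm_sub_le`, `eLpNorm_lim_le_liminf_eLpNorm`,
`eLpNorm_le_eLpNorm_mul_rpow_measure_univ`, `integral_integral_swap`,
`ENNReal.lintegral_mul_le_Lp_mul_Lq`, `lintegral_neg_eq_self` (used); tree: files 1–3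
(`eLpNorm_le_of_weakType`, `weakType_of_eLpNorm_le`, `weakType_one_one`).

## References

* E. M. Stein, *Singular integrals and differentiability properties of functions*, Princeton
  Math. Series 30 (1970): Ch. II §2.2 Theorem 1, §2.5 (a)–(c), §3.1 Corollary, §3.2 Theorem 2.
  [`Stein1971`]
-/

noncomputable section

open MeasureTheory Metric Set Filter Function
open scoped ENNReal NNReal Topology

namespace Literature.Analysis.SingularIntegrals

universe u

variable {E : Type u} [NormedAddCommGroup E] [NormedSpace ℝ E] [FiniteDimensional ℝ E]
  [MeasurableSpace E] [BorelSpace E] {μ : Measure E} [μ.IsAddHaarMeasure]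

/-! ### The admissible class: bounded, compactly supported, measurable functions -/

omit [NormedSpace ℝ E] [FiniteDimensional ℝ E] [BorelSpace E] [μ.IsAddHaarMeasure] in
/-- Bounded compactly supported measurable functions are in every `L^p`. [folklore] -/
theorem memLp_of_bdd_of_hasCompactSupport [IsFiniteMeasureOnCompacts μ] {f : E → ℝ}
    (hf : Measurable f) {C : ℝ} (hC : ∀ x, |f x| ≤ C) (hfc : HasCompactSupport f) (p : ℝ≥0∞) :
    MemLp f p μ := by
  have htop : MemLp f ∞ μ := memLp_top_of_bound hf.aestronglyMeasurable C
    (Eventually.of_forall fun x => by rw [Real.norm_eq_abs]; exact hC x)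
  exact htop.mono_exponent_of_measure_support_ne_top (s := tsupport f)
    (fun x hx => image_eq_zero_of_notMem_tsupport hx) hfc.isCompact.measure_lt_top.ne le_top

omit [NormedSpace ℝ E] [FiniteDimensional ℝ E] [MeasurableSpace E] [BorelSpace E] in
/-- Cutting an admissible function along a set keeps the sup bound and the compact support. [folklore] -/
theorem bdd_and_hasCompactSupport_indicator {f : E → ℝ} {C : ℝ} (hC : ∀ x, |f x| ≤ C)
    (hfc : HasCompactSupport f) (s : Set E) :
    (∀ x, |s.indicator f x| ≤ C) ∧ HasCompactSupport (s.indicator f) := by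
  refine ⟨fun x => ?_, hfc.mono ?_⟩
  · rw [← Real.norm_eq_abs]
    exact (norm_indicator_le_norm_self f x).trans (by rw [Real.norm_eq_abs]; exact hC x)
  · rw [support_indicator]
    exact inter_subset_right

section Operator

variable {k : E → ℝ} {M : ℝ}

omit [μ.IsAddHaarMeasure] in
/-- Linearity: `T(f - g) = Tf - Tg` pointwise for `f, g ∈ L¹`. [folklore] -/
theorem integral_sub_mul_kernel (hk : Measurable k) (hM : ∀ x, |k x| ≤ M) {f g : E → ℝ}
    (hf : Integrable f μ) (hg : Integrable g μ) (x : E) :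
    ∫ t, (f t - g t) * k (x - t) ∂μ = ∫ t, f t * k (x - t) ∂μ - ∫ t, g t * k (x - t) ∂μ := by
  rw [← integral_sub (integrable_mul_kernel hk hM hf x) (integrable_mul_kernel hk hM hg x)]
  exact integral_congr_ae (Eventually.of_forall fun t => by ring)

omit [μ.IsAddHaarMeasure] in
/-- Linearity: `T(f + g) = Tf + Tg` pointwise for `f, g ∈ L¹`. [folklore] -/
theorem integral_add_mul_kernel (hk : Measurable k) (hM : ∀ x, |k x| ≤ M) {f g : E → ℝ}
    (hf : Integrable f μ) (hg : Integrable g μ) (x : E) :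
    ∫ t, (f t + g t) * k (x - t) ∂μ = ∫ t, f t * k (x - t) ∂μ + ∫ t, g t * k (x - t) ∂μ := by
  rw [← integral_add (integrable_mul_kernel hk hM hf x) (integrable_mul_kernel hk hM hg x)]
  exact integral_congr_ae (Eventually.of_forall fun t => by ring)

omit [μ.IsAddHaarMeasure] in
/-- **The pairing identity** `∫ (Tf) g = ∫ f (T̃g)` (Stein 1970, Ch. II §2.5 (c): "the double
integral converges absolutely; its value is therefore …"), `T̃` the operator with the reflected
kernel: `∫ₓ (∫ₜ f(t)k(x-t)) g(x) = ∫ₜ f(t) (∫ₓ g(x)k(x-t))` for `f, g ∈ L¹`, `k` bounded. [cite: Stein1971, Ch. II §2.5] -/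
theorem integral_integral_mul_kernel_mul [SFinite μ] (hk : Measurable k) (hM : ∀ x, |k x| ≤ M)
    {f g : E → ℝ} (hfm : Measurable f) (hf : Integrable f μ) (hgm : Measurable g) (hg : Integrable g μ) :
    ∫ x, (∫ t, f t * k (x - t) ∂μ) * g x ∂μ = ∫ t, f t * (∫ x, g x * k (x - t) ∂μ) ∂μ := by
  set Φ : E → E → ℝ := fun x t => f t * k (x - t) * g x with hΦ
  have hΦm : Measurable (uncurry Φ) :=
    ((hfm.comp measurable_snd).mul (hk.comp (measurable_fst.sub measurable_snd))).mul (hgm.comp measurable_fst)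
  have hΦi : Integrable (uncurry Φ) (μ.prod μ) := by
    have hdom : Integrable (fun z : E × E => |g z.1| * (M * |f z.2|)) (μ.prod μ) :=
      hg.abs.mul_prod (hf.abs.const_mul M)
    refine hdom.mono' hΦm.aestronglyMeasurable (Eventually.of_forall fun z => ?_)
    simp only [uncurry, hΦ, Real.norm_eq_abs, abs_mul]
    have hkz := hM (z.1 - z.2)
    calc |f z.2| * |k (z.1 - z.2)| * |g z.1| ≤ |f z.2| * M * |g z.1| := by gcongr
      _ = |g z.1| * (M * |f z.2|) := by ring
  have hswap := integral_integral_swap hΦi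
  simp only [hΦ] at hswap
  calc ∫ x, (∫ t, f t * k (x - t) ∂μ) * g x ∂μ = ∫ x, ∫ t, f t * k (x - t) * g x ∂μ ∂μ := by
        refine integral_congr_ae (Eventually.of_forall fun x => ?_)
        exact (integral_mul_const _ _).symm
    _ = ∫ t, ∫ x, f t * k (x - t) * g x ∂μ ∂μ := hswap
    _ = ∫ t, f t * (∫ x, g x * k (x - t) ∂μ) ∂μ := by
        refine integral_congr_ae (Eventually.of_forall fun t => ?_)
        dsimp only
        rw [← integral_const_mul]
        exact integral_congr_ae (Eventually.of_forall fun x => by ring)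

/-! ### Density: from continuous compactly supported functions to the admissible class -/

/-- **Extension by density** (Stein 1970, Ch. II §2.2: "One can thus extend `T` to all of `L^p`
by continuity"): if `‖Th‖_p ≤ A‖h‖_p` for continuous compactly supported `h` (`1 ≤ p < ∞`), then
the same holds for bounded compactly supported measurable `f` (approximate `f` in `L^p ∩ L¹` by
clipped, cut-off `C_c` functions; `T : L¹ → L^∞` is continuous; Fatou). [cite: Stein1971, Ch. II §2.2 Thm 1] -/
theorem eLpNorm_le_of_continuous (hk : Measurable k) (hM : ∀ x, |k x| ≤ M) {p : ℝ≥0∞} (hp1 : 1 ≤ p)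
    (hp : p ≠ ⊤) {A : ℝ≥0}
    (hA : ∀ h : E → ℝ, Continuous h → HasCompactSupport h →
      eLpNorm (fun x => ∫ t, h t * k (x - t) ∂μ) p μ ≤ A * eLpNorm h p μ)
    {f : E → ℝ} (hf : Measurable f) {C : ℝ} (hC : ∀ x, |f x| ≤ C) (hfc : HasCompactSupport f) :
    eLpNorm (fun x => ∫ t, f t * k (x - t) ∂μ) p μ ≤ A * eLpNorm f p μ := by
  have hp0 : p ≠ 0 := (zero_lt_one.trans_le hp1).ne'
  obtain ⟨R, hR⟩ : ∃ R : ℝ, tsupport f ⊆ closedBall (0 : E) R :=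
    hfc.isCompact.isBounded.subset_closedBall 0
  have hf_zero : ∀ x, R < ‖x‖ → f x = 0 := fun x hx =>
    image_eq_zero_of_notMem_tsupport fun h => (not_le.2 hx) (mem_closedBall_zero_iff.1 (hR h))
  have hfi : Integrable f μ := integrable_of_bdd_of_hasCompactSupport hf hC hfc
  have hfp : MemLp f p μ := memLp_of_bdd_of_hasCompactSupport hf hC hfc p
  /- the cutoff `ψ` and the clipping -/
  set ψ : E → ℝ := fun x => max 0 (min 1 (R + 1 - ‖x‖)) with hψ
  have hψc : Continuous ψ :=
    continuous_const.max (continuous_const.min (continuous_const.sub continuous_norm))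
  have hψ0 : ∀ x, 0 ≤ ψ x := fun x => le_max_left _ _
  have hψ1 : ∀ x, ψ x ≤ 1 := fun x => max_le zero_le_one (min_le_left _ _)
  have hψ_one : ∀ x, ‖x‖ ≤ R → ψ x = 1 := fun x hx => by
    simp only [hψ]
    rw [min_eq_left (by linarith), max_eq_right zero_le_one]
  have hψ_zero : ∀ x, R + 1 < ‖x‖ → ψ x = 0 := fun x hx => by
    simp only [hψ]
    rw [max_eq_left]
    exact min_le_of_right_le (by linarith)
  set clip : ℝ → ℝ := fun t => max (min t C) (-C) with hclip
  have hclipc : Continuous clip := (continuous_id.min continuous_const).max continuous_const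
  have hclip_lip : ∀ t u, |clip t - clip u| ≤ |t - u| := fun t u =>
    (abs_max_sub_max_le_abs _ _ _).trans (by simpa using abs_min_sub_min_le_max t C u C)
  have hclip_f : ∀ x, clip (f x) = f x := fun x => by
    have h := abs_le.1 (hC x)
    simp only [hclip, min_eq_left h.2, max_eq_left h.1]
  have hclip_abs : ∀ t, |clip t| ≤ |t| := fun t => by
    have h0 : clip 0 = 0 := by
      have hC0 : 0 ≤ C := (abs_nonneg _).trans (hC 0)
      simp only [hclip, min_eq_left hC0, max_eq_left (neg_nonpos.2 hC0)]
    simpa [h0] using hclip_lip t 0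
  /- the approximating sequence -/
  have happrox : ∀ m : ℕ, ∃ h : E → ℝ, HasCompactSupport h ∧ eLpNorm (f - h) p μ ≤ ((m : ℝ≥0∞) + 1)⁻¹ ∧
      Continuous h ∧ MemLp h p μ := fun m =>
    hfp.exists_hasCompactSupport_eLpNorm_sub_le hp (ENNReal.inv_ne_zero.2 (by finiteness))
  choose h _ hhε hhc _ using happrox
  set φ : ℕ → E → ℝ := fun m x => ψ x * clip (h m x) with hφ
  have hφc : ∀ m, Continuous (φ m) := fun m => hψc.mul (hclipc.comp (hhc m))
  have hφ_supp : ∀ m x, R + 1 < ‖x‖ → φ m x = 0 := fun m x hx => by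
    simp only [hφ, hψ_zero x hx, zero_mul]
  have hφcs : ∀ m, HasCompactSupport (φ m) := fun m =>
    HasCompactSupport.intro (isCompact_closedBall (0 : E) (R + 1)) fun x hx =>
      hφ_supp m x (lt_of_not_ge fun h' => hx (mem_closedBall_zero_iff.2 h'))
  have hφ_bdd : ∀ m x, |φ m x| ≤ C := fun m x => by
    simp only [hφ, abs_mul, abs_of_nonneg (hψ0 x)]
    have : |clip (h m x)| ≤ C := abs_le.2 ⟨le_max_right _ _, max_le (min_le_right _ _)
      (neg_le_self ((abs_nonneg _).trans (hC 0)))⟩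
    nlinarith [hψ1 x, hψ0 x, abs_nonneg (clip (h m x))]
  -- the key pointwise comparison `|φ m - f| ≤ |h m - f|`
  have hφ_le : ∀ m x, |φ m x - f x| ≤ |h m x - f x| := by
    intro m x
    by_cases hx : ‖x‖ ≤ R
    · simp only [hφ, hψ_one x hx, one_mul]
      conv_lhs => rw [← hclip_f x]
      exact hclip_lip _ _
    · rw [not_le] at hx
      rw [hf_zero x hx, sub_zero, sub_zero]
      simp only [hφ, abs_mul, abs_of_nonneg (hψ0 x)]
      exact (mul_le_of_le_one_left (abs_nonneg _) (hψ1 x)).trans (hclip_abs _)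
  have hφi : ∀ m, Integrable (φ m) μ := fun m =>
    integrable_of_bdd_of_hasCompactSupport (hφc m).measurable (hφ_bdd m) (hφcs m)
  /- `φ m → f` in `L^p` and in `L¹` -/
  have hLp : ∀ m, eLpNorm (fun x => φ m x - f x) p μ ≤ ((m : ℝ≥0∞) + 1)⁻¹ := fun m => by
    refine (eLpNorm_mono fun x => ?_).trans (hhε m)
    rw [Real.norm_eq_abs, Pi.sub_apply, Real.norm_eq_abs, abs_sub_comm (f x)]
    exact hφ_le m x
  set K₁ : Set E := closedBall (0 : E) (R + 1) with hK₁
  have hK₁ : μ K₁ < ⊤ := measure_closedBall_lt_top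
  have hsupp_diff : ∀ m, support (fun x => φ m x - f x) ⊆ K₁ := by
    intro m x hx
    by_contra hxK
    have hxR : R + 1 < ‖x‖ := lt_of_not_ge fun h' => hxK (mem_closedBall_zero_iff.2 h')
    exact hx (by simp only [hφ_supp m x hxR, hf_zero x (by linarith), sub_zero])
  set δ : ℕ → ℝ≥0∞ := fun m => ((m : ℝ≥0∞) + 1)⁻¹ * μ K₁ ^ (1 - 1 / p.toReal) with hδ
  have hL1 : ∀ m, ∫⁻ x, ‖φ m x - f x‖ₑ ∂μ ≤ δ m := by
    intro m
    have hmeas : AEStronglyMeasurable (fun x => φ m x - f x) μ :=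
      ((hφc m).measurable.sub hf).aestronglyMeasurable
    calc ∫⁻ x, ‖φ m x - f x‖ₑ ∂μ = eLpNorm (fun x => φ m x - f x) 1 (μ.restrict K₁) := by
          rw [eLpNorm_one_eq_lintegral_enorm, ← lintegral_indicator measurableSet_closedBall]
          refine lintegral_congr fun x => ?_
          by_cases hx : x ∈ K₁
          · rw [indicator_of_mem hx]
          · rw [indicator_of_notMem hx, notMem_support.1 fun h' => hx (hsupp_diff m h'), enorm_zero]
      _ ≤ eLpNorm (fun x => φ m x - f x) p (μ.restrict K₁) * (μ.restrict K₁) univ ^ (1 / (1 : ℝ≥0∞).toReal - 1 / p.toReal) :=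
          eLpNorm_le_eLpNorm_mul_rpow_measure_univ hp1 hmeas.restrict
      _ = eLpNorm (fun x => φ m x - f x) p μ * μ K₁ ^ (1 - 1 / p.toReal) := by
          rw [eLpNorm_restrict_eq_of_support_subset (hsupp_diff m), Measure.restrict_apply_univ,
            ENNReal.toReal_one, div_one]
      _ ≤ δ m := by simp only [hδ]; gcongr; exact hLp m
  have hexp0 : 0 ≤ 1 - 1 / p.toReal := by
    simp only [sub_nonneg]
    refine div_le_one_of_le₀ ?_ ENNReal.toReal_nonneg
    rw [← ENNReal.toReal_one]
    exact ENNReal.toReal_mono hp hp1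
  have hinv_tendsto : Tendsto (fun m : ℕ => ((m : ℝ≥0∞) + 1)⁻¹) atTop (𝓝 0) := by
    have := ENNReal.tendsto_inv_nat_nhds_zero.comp (tendsto_add_atTop_nat 1)
    refine this.congr fun m => ?_
    show ((m + 1 : ℕ) : ℝ≥0∞)⁻¹ = ((m : ℝ≥0∞) + 1)⁻¹
    rw [Nat.cast_add, Nat.cast_one]
  have hδ_tendsto : Tendsto δ atTop (𝓝 0) := by
    have h2 := ENNReal.Tendsto.mul_const (b := μ K₁ ^ (1 - 1 / p.toReal)) hinv_tendsto
      (Or.inr (ENNReal.rpow_ne_top_of_nonneg hexp0 hK₁.ne))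
    rwa [zero_mul] at h2
  /- pointwise convergence of the operators -/
  have hT_tendsto : ∀ x, Tendsto (fun m => ∫ t, φ m t * k (x - t) ∂μ) atTop (𝓝 (∫ t, f t * k (x - t) ∂μ)) := by
    intro x
    have hM0 : 0 ≤ M := (abs_nonneg _).trans (hM 0)
    rw [tendsto_iff_norm_sub_tendsto_zero]
    have hbound : ∀ m, ‖(∫ t, φ m t * k (x - t) ∂μ) - ∫ t, f t * k (x - t) ∂μ‖ ≤ M * (δ m).toReal := by
      intro m
      rw [← integral_sub_mul_kernel hk hM (hφi m) hfi x, Real.norm_eq_abs]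
      refine (abs_integral_mul_kernel_le hM ((hφi m).sub hfi) x).trans ?_
      gcongr
      have hne : δ m ≠ ⊤ := ENNReal.mul_ne_top (ENNReal.inv_ne_top.2 (by positivity))
        (ENNReal.rpow_ne_top_of_nonneg hexp0 hK₁.ne)
      rw [integral_eq_lintegral_of_nonneg_ae (Eventually.of_forall fun t => abs_nonneg _)
        ((hφi m).sub hfi).abs.aestronglyMeasurable]
      refine ENNReal.toReal_mono hne ((le_of_eq (lintegral_congr fun t => ?_)).trans (hL1 m))
      rw [← Real.enorm_eq_ofReal_abs]
      rfl
    refine squeeze_zero (fun m => norm_nonneg _) hbound ?_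
    have := (ENNReal.tendsto_toReal ENNReal.zero_ne_top).comp hδ_tendsto
    rw [ENNReal.toReal_zero] at this
    simpa using this.const_mul M
  /- Fatou -/
  have hFatou := Lp.eLpNorm_lim_le_liminf_eLpNorm (μ := μ) (p := p)
    (f := fun m x => ∫ t, φ m t * k (x - t) ∂μ)
    (fun m => (stronglyMeasurable_integral_mul_kernel hk (hφc m).measurable).aestronglyMeasurable)
    (fun x => ∫ t, f t * k (x - t) ∂μ) (Eventually.of_forall hT_tendsto)
  refine hFatou.trans ?_
  -- the approximants obey the bound, with `‖φ m‖_p ≤ ‖f‖_p + (m+1)⁻¹`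
  set v : ℕ → ℝ≥0∞ := fun m => A * (eLpNorm f p μ + ((m : ℝ≥0∞) + 1)⁻¹) with hv
  have hle : ∀ m, eLpNorm (fun x => ∫ t, φ m t * k (x - t) ∂μ) p μ ≤ v m := by
    intro m
    refine (hA (φ m) (hφc m) (hφcs m)).trans ?_
    simp only [hv]
    gcongr
    have hsplit : φ m = f + fun x => φ m x - f x := by funext x; simp
    calc eLpNorm (φ m) p μ = eLpNorm (f + fun x => φ m x - f x) p μ := by rw [← hsplit]
      _ ≤ eLpNorm f p μ + eLpNorm (fun x => φ m x - f x) p μ :=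
          eLpNorm_add_le hf.aestronglyMeasurable ((hφc m).measurable.sub hf).aestronglyMeasurable hp1
      _ ≤ eLpNorm f p μ + ((m : ℝ≥0∞) + 1)⁻¹ := add_le_add le_rfl (hLp m)
  have hv_tendsto : Tendsto v atTop (𝓝 (A * eLpNorm f p μ)) := by
    have h2 : Tendsto (fun m : ℕ => eLpNorm f p μ + ((m : ℝ≥0∞) + 1)⁻¹) atTop (𝓝 (eLpNorm f p μ + 0)) :=
      tendsto_const_nhds.add hinv_tendsto
    rw [add_zero] at h2
    exact ENNReal.Tendsto.const_mul h2 (Or.inr ENNReal.coe_ne_top)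
  calc liminf (fun m => eLpNorm (fun x => ∫ t, φ m t * k (x - t) ∂μ) p μ) atTop
      ≤ liminf v atTop := liminf_le_liminf (Eventually.of_forall hle)
    _ = A * eLpNorm f p μ := hv_tendsto.liminf_eq

/-! ### `1 < p < 2`: Marcinkiewicz between weak type (1,1) and type (2,2) -/

/-- **`L^p` bound for `1 < p < 2`** (Stein 1970, Ch. II §2.5 (b)): under the hypotheses of
`weakType_one_one` (bounded measurable kernel, `L²` bound `A` on the admissible class,
Hörmander constant `B`), for `1 < p < 2` and admissible `f`,
`‖Tf‖_p ≤ [p (2A₁(p-1)⁻¹ + 4A²(2-p)⁻¹)]^{1/p} ‖f‖_p` with `A₁ = 4ⁿ⁺¹A² + 8ⁿ + 4B`. [cite: Stein1971, Ch. II §2.5] -/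
theorem eLpNorm_le_of_lt_two [Nontrivial E] (hk : Measurable k) (hM : ∀ x, |k x| ≤ M) {A B : ℝ≥0}
    (hL2 : ∀ f : E → ℝ, Measurable f → (∃ C, ∀ x, |f x| ≤ C) → HasCompactSupport f →
      eLpNorm (fun x => ∫ t, f t * k (x - t) ∂μ) 2 μ ≤ A * eLpNorm f 2 μ)
    (hH : ∀ y : E, ∫⁻ x in {x | 2 * ‖y‖ ≤ ‖x‖}, ‖k (x - y) - k x‖ₑ ∂μ ≤ B)
    {p : ℝ≥0∞} (hp1 : 1 < p) (hp2 : p < 2)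
    {f : E → ℝ} (hf : Measurable f) (hfb : ∃ C, ∀ x, |f x| ≤ C) (hfc : HasCompactSupport f) :
    eLpNorm (fun x => ∫ t, f t * k (x - t) ∂μ) p μ ≤
      (ENNReal.ofReal p.toReal *
          (2 * ((4 ^ (Module.finrank ℝ E + 1) * A ^ 2 + 8 ^ Module.finrank ℝ E + 4 * B : ℝ≥0) : ℝ≥0∞) *
              ENNReal.ofReal (p.toReal - 1)⁻¹ +
            2 ^ (2 : ℝ) * (A : ℝ≥0∞) ^ (2 : ℝ) * ENNReal.ofReal (2 - p.toReal)⁻¹)) ^ (1 / p.toReal) *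
        eLpNorm f p μ := by
  -- the admissible class and the operator
  set P : (E → ℝ) → Prop := fun f => Measurable f ∧ (∃ C, ∀ x, |f x| ≤ C) ∧ HasCompactSupport f with hP
  set T : (E → ℝ) → E → ℝ := fun f x => ∫ t, f t * k (x - t) ∂μ with hT
  have hP_gt : ∀ f, P f → ∀ t : ℝ, 0 < t → P ({x | t < ‖f x‖}.indicator f) := by
    rintro f ⟨hfm, ⟨C, hC⟩, hfc⟩ t _
    obtain ⟨h1, h2⟩ := bdd_and_hasCompactSupport_indicator hC hfc {x | t < ‖f x‖}
    exact ⟨hfm.indicator (measurableSet_lt measurable_const hfm.norm), ⟨C, h1⟩, h2⟩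
  have hP_le : ∀ f, P f → ∀ t : ℝ, 0 < t → P ({x | ‖f x‖ ≤ t}.indicator f) := by
    rintro f ⟨hfm, ⟨C, hC⟩, hfc⟩ t _
    obtain ⟨h1, h2⟩ := bdd_and_hasCompactSupport_indicator hC hfc {x | ‖f x‖ ≤ t}
    exact ⟨hfm.indicator (measurableSet_le hfm.norm measurable_const), ⟨C, h1⟩, h2⟩
  have hP_meas : ∀ f, P f → AEStronglyMeasurable f μ := fun f hf => hf.1.aestronglyMeasurable
  have hT_meas : ∀ f, P f → AEStronglyMeasurable (T f) μ := fun f hf =>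
    (stronglyMeasurable_integral_mul_kernel hk hf.1).aestronglyMeasurable
  have hP_int : ∀ f, P f → Integrable f μ := by
    rintro f ⟨hfm, ⟨C, hC⟩, hfc⟩
    exact integrable_of_bdd_of_hasCompactSupport hfm hC hfc
  have hT_sub : ∀ f g, P f → P g → ∀ᵐ y ∂μ, ‖T (f + g) y‖ ≤ ‖T f y‖ + ‖T g y‖ := by
    intro f g hf hg
    refine Eventually.of_forall fun y => ?_
    have : T (f + g) y = T f y + T g y := by
      simp only [hT, Pi.add_apply]
      exact integral_add_mul_kernel hk hM (hP_int f hf) (hP_int g hg) y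
    rw [this]
    exact norm_add_le _ _
  set A₁ : ℝ≥0 := 4 ^ (Module.finrank ℝ E + 1) * A ^ 2 + 8 ^ Module.finrank ℝ E + 4 * B with hA₁
  have h₁ : ∀ f, P f → ∀ s : ℝ, 0 < s →
      ENNReal.ofReal s * μ {y | s < ‖T f y‖} ≤ A₁ * ∫⁻ x, ‖f x‖ₑ ∂μ := by
    rintro f ⟨hfm, hfb, hfc⟩ s hs
    have h := weakType_one_one (μ := μ) hk hM hL2 hH hfm hfb hfc hs
    have hA₁' : ((A₁ : ℝ≥0) : ℝ≥0∞) = 4 ^ (Module.finrank ℝ E + 1) * (A : ℝ≥0∞) ^ 2 + 8 ^ Module.finrank ℝ E + 4 * B := by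
      simp only [hA₁]; push_cast; ring
    rw [hA₁']
    simpa only [Real.norm_eq_abs] using h
  have h₂ : ∀ f, P f → ∀ s : ℝ, 0 < s →
      ENNReal.ofReal s ^ (2 : ℝ) * μ {y | s < ‖T f y‖} ≤ (A : ℝ≥0∞) ^ (2 : ℝ) * ∫⁻ x, ‖f x‖ₑ ^ (2 : ℝ) ∂μ := by
    rintro f ⟨hfm, hfb, hfc⟩ s _
    have h := weakType_of_eLpNorm_le (μ := μ) (ν := μ) (f := f) (g := T f) (q := 2) two_ne_zero
      ENNReal.ofNat_ne_top (hT_meas f ⟨hfm, hfb, hfc⟩) (hL2 f hfm hfb hfc) s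
    simpa only [ENNReal.toReal_ofNat] using h
  have hpr : p < ENNReal.ofReal 2 := by rwa [ENNReal.ofReal_ofNat]
  exact eLpNorm_le_of_weakType P T hP_gt hP_le hP_meas hT_meas hT_sub h₁ h₂ hp1 hpr ⟨hf, hfb, hfc⟩

/-! ### Duality: `2 < p < ∞` from the reflected kernel -/

/-- **The duality step** (Stein 1970, Ch. II §2.5 (c)). Let `1 < p, q < ∞` be conjugate
exponents and suppose the operator with the reflected kernel `k(-x)` is bounded on `L^q` over the
admissible class with constant `A`. Then `‖Tf‖_p ≤ A‖f‖_p` for admissible `f` (test `Tf`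
against `φ_R = 1_{B̄(0,R)} Tf |Tf|^{p-2}`, use the pairing identity and Hölder, let `R → ∞`). [cite: Stein1971, Ch. II §2.5] -/
theorem eLpNorm_le_of_adjoint (hk : Measurable k) (hM : ∀ x, |k x| ≤ M) {p q : ℝ}
    (hpq : p.HolderConjugate q) {A : ℝ≥0∞}
    (hadj : ∀ g : E → ℝ, Measurable g → (∃ C, ∀ x, |g x| ≤ C) → HasCompactSupport g →
      eLpNorm (fun t => ∫ x, g x * k (-(t - x)) ∂μ) (ENNReal.ofReal q) μ ≤
        A * eLpNorm g (ENNReal.ofReal q) μ)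
    {f : E → ℝ} (hf : Measurable f) {C : ℝ} (hC : ∀ x, |f x| ≤ C) (hfc : HasCompactSupport f) :
    eLpNorm (fun x => ∫ t, f t * k (x - t) ∂μ) (ENNReal.ofReal p) μ ≤ A * eLpNorm f (ENNReal.ofReal p) μ := by
  have hp : 1 < p := hpq.lt
  have hq : 1 < q := hpq.symm.lt
  have hp0 : 0 < p := hpq.pos
  have hq0 : 0 < q := hpq.symm.pos
  have hP0 : ENNReal.ofReal p ≠ 0 := (ENNReal.ofReal_pos.2 hp0).ne'
  have hQ0 : ENNReal.ofReal q ≠ 0 := (ENNReal.ofReal_pos.2 hq0).ne'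
  have hfi : Integrable f μ := integrable_of_bdd_of_hasCompactSupport hf hC hfc
  set F : E → ℝ := fun x => ∫ t, f t * k (x - t) ∂μ with hF
  have hFm : Measurable F := (stronglyMeasurable_integral_mul_kernel hk hf).measurable
  have hFabs : Measurable fun x => |F x| := continuous_abs.measurable.comp hFm
  set MF : ℝ := M * ∫ t, |f t| ∂μ with hMF
  have hFbd : ∀ x, |F x| ≤ MF := fun x => abs_integral_mul_kernel_le hM hfi x
  have hMF0 : 0 ≤ MF := (abs_nonneg _).trans (hFbd 0)
  /- the test functions -/
  set gR : ℝ → E → ℝ := fun R x => (closedBall (0 : E) R).indicator (fun x => F x * |F x| ^ (p - 2)) x with hgR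
  have hgRm : ∀ R, Measurable (gR R) := fun R =>
    (hFm.mul (hFabs.pow_const _)).indicator measurableSet_closedBall
  have hcore_abs : ∀ x, |F x * |F x| ^ (p - 2)| = |F x| ^ (p - 1) := by
    intro x
    rcases eq_or_ne (F x) 0 with h0 | h0
    · rw [h0, abs_zero, zero_mul, abs_zero, Real.zero_rpow (by linarith)]
    · rw [abs_mul, abs_of_nonneg (Real.rpow_nonneg (abs_nonneg _) _),
        show p - 1 = 1 + (p - 2) by ring, Real.rpow_add (abs_pos.2 h0), Real.rpow_one]
  have hgR_bdd : ∀ R x, |gR R x| ≤ MF ^ (p - 1) := by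
    intro R x
    simp only [hgR]
    by_cases hx : x ∈ closedBall (0 : E) R
    · rw [indicator_of_mem hx, hcore_abs]
      exact Real.rpow_le_rpow (abs_nonneg _) (hFbd x) (by linarith)
    · rw [indicator_of_notMem hx, abs_zero]
      positivity
  have hgR_cs : ∀ R, HasCompactSupport (gR R) := fun R =>
    HasCompactSupport.intro (isCompact_closedBall (0 : E) R) fun x hx => indicator_of_notMem hx _
  -- `F · gR = 1_{B_R} |F|^p` and `|gR|^q = 1_{B_R} |F|^p`
  have hFg : ∀ R x, F x * gR R x = (closedBall (0 : E) R).indicator (fun x => |F x| ^ p) x := by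
    intro R x
    simp only [hgR]
    by_cases hx : x ∈ closedBall (0 : E) R
    · rw [indicator_of_mem hx, indicator_of_mem hx]
      rcases eq_or_ne (F x) 0 with h0 | h0
      · rw [h0, zero_mul, abs_zero, Real.zero_rpow hp0.ne']
      · have : F x * F x = |F x| ^ (2 : ℝ) := by rw [Real.rpow_two, sq_abs, sq]
        rw [← mul_assoc, this, ← Real.rpow_add (abs_pos.2 h0)]
        ring_nf
    · rw [indicator_of_notMem hx, indicator_of_notMem hx, mul_zero]
  have hgq : ∀ R x, ‖gR R x‖ₑ ^ q = (closedBall (0 : E) R).indicator (fun x => ‖F x‖ₑ ^ p) x := by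
    intro R x
    simp only [hgR]
    by_cases hx : x ∈ closedBall (0 : E) R
    · rw [indicator_of_mem hx, indicator_of_mem hx, Real.enorm_eq_ofReal_abs, hcore_abs,
        Real.enorm_eq_ofReal_abs, ENNReal.ofReal_rpow_of_nonneg (by positivity) hq0.le,
        ENNReal.ofReal_rpow_of_nonneg (abs_nonneg _) hp0.le, ← Real.rpow_mul (abs_nonneg _),
        hpq.sub_one_mul_conj]
    · rw [indicator_of_notMem hx, indicator_of_notMem hx, enorm_zero, ENNReal.zero_rpow_of_pos hq0]
  /- the truncated `L^p` masses `I R = ∫_{B_R} |F|^p` -/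
  set I : ℝ → ℝ≥0∞ := fun R => ∫⁻ x in closedBall (0 : E) R, ‖F x‖ₑ ^ p ∂μ with hI
  have hI_top : ∀ R, I R ≠ ⊤ := by
    intro R
    refine ne_top_of_le_ne_top (ENNReal.mul_ne_top ENNReal.ofReal_ne_top measure_closedBall_lt_top.ne)
      (?_ : I R ≤ ENNReal.ofReal (MF ^ p) * μ (closedBall (0 : E) R))
    calc I R ≤ ∫⁻ x in closedBall (0 : E) R, ENNReal.ofReal (MF ^ p) ∂μ := by
          refine lintegral_mono fun x => ?_
          rw [Real.enorm_eq_ofReal_abs, ENNReal.ofReal_rpow_of_nonneg (abs_nonneg _) hp0.le]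
          exact ENNReal.ofReal_le_ofReal (Real.rpow_le_rpow (abs_nonneg _) (hFbd x) hp0.le)
      _ = ENNReal.ofReal (MF ^ p) * μ (closedBall (0 : E) R) := setLIntegral_const _ _
  -- `‖gR‖_q^q = I R`
  have hgR_norm : ∀ R, ∫⁻ x, ‖gR R x‖ₑ ^ q ∂μ = I R := by
    intro R
    simp only [hI]
    rw [← lintegral_indicator measurableSet_closedBall]
    exact lintegral_congr fun x => hgq R x
  -- `I R = ofReal ∫ F gR`
  have hFgi : ∀ R, Integrable (fun x => F x * gR R x) μ := by
    intro R
    have heq : (fun x => F x * gR R x) = (closedBall (0 : E) R).indicator fun x => |F x| ^ p :=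
      funext (hFg R)
    rw [heq]
    refine IntegrableOn.integrable_indicator ?_ measurableSet_closedBall
    exact Measure.integrableOn_of_bounded (M := MF ^ p) measure_closedBall_lt_top.ne
      (hFabs.pow_const _).aestronglyMeasurable (Eventually.of_forall fun x => by
        rw [Real.norm_eq_abs, abs_of_nonneg (Real.rpow_nonneg (abs_nonneg _) _)]
        exact Real.rpow_le_rpow (abs_nonneg _) (hFbd x) hp0.le)
  have hI_eq : ∀ R, I R = ENNReal.ofReal (∫ x, F x * gR R x ∂μ) := by
    intro R
    rw [ofReal_integral_eq_lintegral_ofReal (hFgi R) (Eventually.of_forall fun x => by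
      show (0 : ℝ) ≤ F x * gR R x
      rw [hFg R x]; exact indicator_nonneg (fun y _ => Real.rpow_nonneg (abs_nonneg _) _) x)]
    simp only [hI]
    rw [← lintegral_indicator measurableSet_closedBall]
    refine lintegral_congr fun x => ?_
    rw [hFg R x]
    by_cases hx : x ∈ closedBall (0 : E) R
    · rw [indicator_of_mem hx, indicator_of_mem hx, Real.enorm_eq_ofReal_abs,
        ENNReal.ofReal_rpow_of_nonneg (abs_nonneg _) hp0.le]
    · rw [indicator_of_notMem hx, indicator_of_notMem hx, ENNReal.ofReal_zero]
  /- the main inequality `I R ≤ ‖f‖_p · A · (I R)^{1/q}` -/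
  have hkey : ∀ R, I R ≤ eLpNorm f (ENNReal.ofReal p) μ * A * I R ^ (1 / q) := by
    intro R
    set G : E → ℝ := fun t => ∫ x, gR R x * k (x - t) ∂μ with hG
    have hGm : Measurable G := by
      have : G = fun t => ∫ x, gR R x * k (-(t - x)) ∂μ := by
        funext t; simp only [hG, neg_sub]
      rw [this]
      exact (stronglyMeasurable_integral_mul_kernel (hk.comp measurable_neg) (hgRm R)).measurable
    have hgRi : Integrable (gR R) μ := integrable_of_bdd_of_hasCompactSupport (hgRm R) (hgR_bdd R) (hgR_cs R)
    -- pairing and Hölder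
    have hpair : ∫ x, F x * gR R x ∂μ = ∫ t, f t * G t ∂μ :=
      integral_integral_mul_kernel_mul hk hM hf hfi (hgRm R) hgRi
    have hGq : eLpNorm G (ENNReal.ofReal q) μ ≤ A * eLpNorm (gR R) (ENNReal.ofReal q) μ := by
      have h := hadj (gR R) (hgRm R) ⟨_, hgR_bdd R⟩ (hgR_cs R)
      have : (fun t => ∫ x, gR R x * k (-(t - x)) ∂μ) = G := by
        funext t; simp only [hG, neg_sub]
      rwa [this] at h
    have hgR_eLp : eLpNorm (gR R) (ENNReal.ofReal q) μ = I R ^ (1 / q) := by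
      rw [eLpNorm_eq_lintegral_rpow_enorm_toReal hQ0 ENNReal.ofReal_ne_top, ENNReal.toReal_ofReal hq0.le,
        hgR_norm R]
    have hf_eLp : eLpNorm f (ENNReal.ofReal p) μ = (∫⁻ t, ‖f t‖ₑ ^ p ∂μ) ^ (1 / p) := by
      rw [eLpNorm_eq_lintegral_rpow_enorm_toReal hP0 ENNReal.ofReal_ne_top, ENNReal.toReal_ofReal hp0.le]
    have hG_eLp : eLpNorm G (ENNReal.ofReal q) μ = (∫⁻ t, ‖G t‖ₑ ^ q ∂μ) ^ (1 / q) := by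
      rw [eLpNorm_eq_lintegral_rpow_enorm_toReal hQ0 ENNReal.ofReal_ne_top, ENNReal.toReal_ofReal hq0.le]
    -- `ofReal ∫ f G ≤ ∫⁻ ‖f‖ₑ ‖G‖ₑ ≤ ‖f‖_p ‖G‖_q`
    have hfGi : Integrable (fun t => f t * G t) μ := by
      have hGbd : ∀ t, |G t| ≤ M * ∫ x, |gR R x| ∂μ := fun t => by
        have h := abs_integral_mul_kernel_le (k := fun z => k (-z)) (M := M) (fun z => hM (-z)) hgRi t
        simp only [neg_sub] at h
        exact h
      exact hfi.mul_bdd hGm.aestronglyMeasurable (Eventually.of_forall fun t => by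
        rw [Real.norm_eq_abs]; exact hGbd t)
    calc I R = ENNReal.ofReal (∫ t, f t * G t ∂μ) := by rw [hI_eq, hpair]
      _ ≤ ENNReal.ofReal (∫ t, |f t * G t| ∂μ) := ENNReal.ofReal_le_ofReal
          (le_trans (le_abs_self _) abs_integral_le_integral_abs)
      _ = ∫⁻ t, ‖f t‖ₑ * ‖G t‖ₑ ∂μ := by
          rw [ofReal_integral_eq_lintegral_ofReal hfGi.abs (Eventually.of_forall fun t => abs_nonneg _)]
          refine lintegral_congr fun t => ?_
          rw [← Real.enorm_eq_ofReal_abs, enorm_mul]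
      _ ≤ (∫⁻ t, ‖f t‖ₑ ^ p ∂μ) ^ (1 / p) * (∫⁻ t, ‖G t‖ₑ ^ q ∂μ) ^ (1 / q) :=
          ENNReal.lintegral_mul_le_Lp_mul_Lq μ hpq hf.enorm.aemeasurable hGm.enorm.aemeasurable
      _ = eLpNorm f (ENNReal.ofReal p) μ * eLpNorm G (ENNReal.ofReal q) μ := by rw [hf_eLp, hG_eLp]
      _ ≤ eLpNorm f (ENNReal.ofReal p) μ * (A * I R ^ (1 / q)) := by rw [← hgR_eLp]; gcongr
      _ = _ := by ring
  /- divide by `(I R)^{1/q}` -/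
  have hIR : ∀ R, I R ≤ (A * eLpNorm f (ENNReal.ofReal p) μ) ^ p := by
    intro R
    rcases eq_or_ne (I R) 0 with h0 | h0
    · rw [h0]; exact zero_le
    have hIp : I R ^ (1 / p) ≤ A * eLpNorm f (ENNReal.ofReal p) μ := by
      have h := hkey R
      have hq' : I R ^ (1 / q) ≠ 0 := (ENNReal.rpow_pos (pos_iff_ne_zero.2 h0) (hI_top R)).ne'
      have hq'' : I R ^ (1 / q) ≠ ⊤ := ENNReal.rpow_ne_top_of_nonneg (by positivity) (hI_top R)
      have hdiv : I R * (I R ^ (1 / q))⁻¹ ≤ eLpNorm f (ENNReal.ofReal p) μ * A := by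
        calc I R * (I R ^ (1 / q))⁻¹ ≤ (eLpNorm f (ENNReal.ofReal p) μ * A * I R ^ (1 / q)) * (I R ^ (1 / q))⁻¹ := by
              gcongr
          _ = eLpNorm f (ENNReal.ofReal p) μ * A := by
              rw [mul_assoc, ENNReal.mul_inv_cancel hq' hq'', mul_one]
      have hexp : I R * (I R ^ (1 / q))⁻¹ = I R ^ (1 / p) := by
        rw [← ENNReal.rpow_neg, ← ENNReal.rpow_one (I R), ← ENNReal.rpow_mul, ← ENNReal.rpow_add _ _ h0 (hI_top R),
          ENNReal.rpow_one]
        congr 1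
        have := hpq.inv_add_inv_eq_one
        field_simp at this ⊢
        linarith
      rw [hexp] at hdiv
      rwa [mul_comm] at hdiv
    calc I R = (I R ^ (1 / p)) ^ p := by
          rw [← ENNReal.rpow_mul, one_div, inv_mul_cancel₀ hp0.ne', ENNReal.rpow_one]
      _ ≤ (A * eLpNorm f (ENNReal.ofReal p) μ) ^ p := ENNReal.rpow_le_rpow hIp hp0.le
  /- `R → ∞` -/
  have hfull : ∫⁻ x, ‖F x‖ₑ ^ p ∂μ ≤ (A * eLpNorm f (ENNReal.ofReal p) μ) ^ p := by
    have hmono : Monotone fun (m : ℕ) => (closedBall (0 : E) m).indicator (fun x => ‖F x‖ₑ ^ p) := by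
      intro m m' hmm' x
      exact indicator_le_indicator_of_subset (closedBall_subset_closedBall (by exact_mod_cast hmm'))
        (fun _ => zero_le) x
    have hsup : (fun x => ‖F x‖ₑ ^ p) = fun x => ⨆ m : ℕ, (closedBall (0 : E) m).indicator (fun x => ‖F x‖ₑ ^ p) x := by
      funext x
      refine le_antisymm ?_ (iSup_le fun m => indicator_le_self _ _ x)
      obtain ⟨m, hm⟩ := exists_nat_ge ‖x‖
      exact le_iSup_of_le m (by rw [indicator_of_mem (mem_closedBall_zero_iff.2 hm)])
    rw [hsup, lintegral_iSup (fun m => (hFm.enorm.pow_const _).indicator measurableSet_closedBall) hmono]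
    refine iSup_le fun m => ?_
    rw [lintegral_indicator measurableSet_closedBall]
    exact hIR m
  rw [eLpNorm_eq_lintegral_rpow_enorm_toReal hP0 ENNReal.ofReal_ne_top, ENNReal.toReal_ofReal hp0.le]
  calc (∫⁻ x, ‖F x‖ₑ ^ p ∂μ) ^ (1 / p) ≤ ((A * eLpNorm f (ENNReal.ofReal p) μ) ^ p) ^ (1 / p) :=
        ENNReal.rpow_le_rpow hfull (by positivity)
    _ = A * eLpNorm f (ENNReal.ofReal p) μ := by
        rw [← ENNReal.rpow_mul, one_div, mul_inv_cancel₀ hp0.ne', ENNReal.rpow_one]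

/-! ### The reflected kernel -/

/-- Hörmander's condition is symmetric under `k ↦ k(-·)` (the reflected kernel of Stein's duality
step, Ch. II §2.5 (c)). [cite: Stein1971, Ch. II §2.5] -/
theorem hormander_neg {B : ℝ≥0}
    (hH : ∀ y : E, ∫⁻ x in {x | 2 * ‖y‖ ≤ ‖x‖}, ‖k (x - y) - k x‖ₑ ∂μ ≤ B) (y : E) :
    ∫⁻ x in {x | 2 * ‖y‖ ≤ ‖x‖}, ‖k (-(x - y)) - k (-x)‖ₑ ∂μ ≤ B := by
  have hS : MeasurableSet {x : E | 2 * ‖y‖ ≤ ‖x‖} := measurableSet_le measurable_const measurable_norm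
  have hS' : MeasurableSet {x : E | 2 * ‖-y‖ ≤ ‖x‖} := measurableSet_le measurable_const measurable_norm
  calc ∫⁻ x in {x | 2 * ‖y‖ ≤ ‖x‖}, ‖k (-(x - y)) - k (-x)‖ₑ ∂μ
      = ∫⁻ x, ({x : E | 2 * ‖-y‖ ≤ ‖x‖}.indicator fun x => ‖k (x - -y) - k x‖ₑ) (-x) ∂μ := by
        rw [← lintegral_indicator hS]
        refine lintegral_congr fun x => ?_
        have e1 : -x - -y = -(x - y) := by abel
        simp only [indicator, mem_setOf_eq, norm_neg, e1]
    _ = ∫⁻ x, {x : E | 2 * ‖-y‖ ≤ ‖x‖}.indicator (fun x => ‖k (x - -y) - k x‖ₑ) x ∂μ := lintegral_neg_eq_self _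
    _ = ∫⁻ x in {x | 2 * ‖-y‖ ≤ ‖x‖}, ‖k (x - -y) - k x‖ₑ ∂μ := lintegral_indicator hS' _
    _ ≤ B := hH (-y)

end Operator

/-! ### The theorem -/

/-- **The `L^p` inequalities for singular integrals** (Stein 1970, Ch. II §2.2 Theorem 1 with
§3.1 Corollary; §3.2 Theorem 2 in the uniform form): for every dimension `n`, constants `A, B`
and exponent `1 < p < ∞` there is a constant `C = C(n, A, B, p)` such that: for every
finite-dimensional real normed space `E` of dimension `n` with additive Haar measure `μ`, every
bounded measurable kernel `k` with `‖∫ h(t)k(·-t)dt‖₂ ≤ A‖h‖₂` for continuous compactly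
supported `h` and `∫_{2‖y‖≤‖x‖} |k(x-y)-k(x)| dμ(x) ≤ B` for all `y`, and every bounded,
compactly supported, measurable `f`, `‖∫ f(t)k(·-t)dt‖_p ≤ C ‖f‖_p`. (`1 < p < 2`:
Marcinkiewicz between the weak type `(1,1)` of file 3 and the type `(2,2)`; `p = 2`: density;
`2 < p < ∞`: the `L^{p'}` bound for the reflected kernel and duality.) [cite: Stein1971, Ch. II §3.2 Thm 2] -/
theorem exists_eLpNorm_le (n : ℕ) (A B : ℝ≥0) {p : ℝ≥0∞} (hp1 : 1 < p) (hp2 : p < ⊤) :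
    ∃ C : ℝ≥0, ∀ {E : Type u} [NormedAddCommGroup E] [NormedSpace ℝ E] [FiniteDimensional ℝ E]
      [MeasurableSpace E] [BorelSpace E] [Nontrivial E] (μ : Measure E) [μ.IsAddHaarMeasure],
      Module.finrank ℝ E = n →
      ∀ {k : E → ℝ}, Measurable k → (∃ M : ℝ, ∀ x, |k x| ≤ M) →
      (∀ h : E → ℝ, Continuous h → HasCompactSupport h →
        eLpNorm (fun x => ∫ t, h t * k (x - t) ∂μ) 2 μ ≤ A * eLpNorm h 2 μ) →
      (∀ y : E, ∫⁻ x in {x | 2 * ‖y‖ ≤ ‖x‖}, ‖k (x - y) - k x‖ₑ ∂μ ≤ B) →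
      ∀ f : E → ℝ, Measurable f → (∃ C' : ℝ, ∀ x, |f x| ≤ C') → HasCompactSupport f →
        eLpNorm (fun x => ∫ t, f t * k (x - t) ∂μ) p μ ≤ C * eLpNorm f p μ := by
  -- the two interpolation constants (finite for every real exponent)
  set A₁ : ℝ≥0 := 4 ^ (n + 1) * A ^ 2 + 8 ^ n + 4 * B with hA₁
  set K : ℝ → ℝ≥0∞ := fun r => (ENNReal.ofReal r * (2 * (A₁ : ℝ≥0∞) * ENNReal.ofReal (r - 1)⁻¹ +
    2 ^ (2 : ℝ) * (A : ℝ≥0∞) ^ (2 : ℝ) * ENNReal.ofReal (2 - r)⁻¹)) ^ (1 / r) with hK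
  have hK_top : ∀ r : ℝ, 0 < r → K r ≠ ⊤ := by
    intro r hr
    refine ENNReal.rpow_ne_top_of_nonneg (by positivity) (ENNReal.mul_ne_top ENNReal.ofReal_ne_top ?_)
    refine ENNReal.add_ne_top.2 ⟨?_, ?_⟩
    · exact ENNReal.mul_ne_top (ENNReal.mul_ne_top (by norm_num) ENNReal.coe_ne_top) ENNReal.ofReal_ne_top
    · exact ENNReal.mul_ne_top (ENNReal.mul_ne_top (ENNReal.rpow_ne_top_of_nonneg zero_le_two (by norm_num))
        (ENNReal.rpow_ne_top_of_nonneg zero_le_two ENNReal.coe_ne_top)) ENNReal.ofReal_ne_top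
  set pr : ℝ := p.toReal with hpr
  set qr : ℝ := pr / (pr - 1) with hqr
  have hp_top : p ≠ ⊤ := hp2.ne
  have hp0 : p ≠ 0 := (zero_lt_one.trans hp1).ne'
  have hpr1 : 1 < pr := by
    rw [hpr, ← ENNReal.toReal_one]
    exact (ENNReal.toReal_lt_toReal ENNReal.one_ne_top hp_top).2 hp1
  have hpq : pr.HolderConjugate qr := Real.HolderConjugate.conjExponent hpr1
  have hqr0 : 0 < qr := hpq.symm.pos
  refine ⟨(K pr + K qr + A).toNNReal, ?_⟩
  intro E _ _ _ _ _ _ μ _ hn k hk hkM hL2c hH f hf hfb hfc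
  obtain ⟨M, hM⟩ := hkM
  obtain ⟨Cf, hCf⟩ := hfb
  have hcoe : (((K pr + K qr + A).toNNReal : ℝ≥0) : ℝ≥0∞) = K pr + K qr + A :=
    ENNReal.coe_toNNReal (ENNReal.add_ne_top.2 ⟨ENNReal.add_ne_top.2
      ⟨hK_top pr (by linarith), hK_top qr hqr0⟩, ENNReal.coe_ne_top⟩)
  rw [hcoe]
  subst hn
  -- the `L²` bound on the admissible class (density), for `k` and for the reflected kernel
  have hL2 : ∀ g : E → ℝ, Measurable g → (∃ C, ∀ x, |g x| ≤ C) → HasCompactSupport g →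
      eLpNorm (fun x => ∫ t, g t * k (x - t) ∂μ) 2 μ ≤ A * eLpNorm g 2 μ := by
    rintro g hgm ⟨C, hC⟩ hgc
    exact eLpNorm_le_of_continuous hk hM one_le_two ENNReal.ofNat_ne_top hL2c hgm hC hgc
  have hkn : Measurable fun z => k (-z) := hk.comp measurable_neg
  have hMn : ∀ x, |(fun z => k (-z)) x| ≤ M := fun x => hM (-x)
  have h22 : (2 : ℝ).HolderConjugate 2 := by
    rw [Real.holderConjugate_iff]; norm_num
  have hL2n : ∀ g : E → ℝ, Measurable g → (∃ C, ∀ x, |g x| ≤ C) → HasCompactSupport g →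
      eLpNorm (fun x => ∫ t, g t * k (-(x - t)) ∂μ) 2 μ ≤ A * eLpNorm g 2 μ := by
    rintro g hgm ⟨C, hC⟩ hgc
    have h := eLpNorm_le_of_adjoint (μ := μ) (k := fun z => k (-z)) (A := (A : ℝ≥0∞)) hkn hMn h22
      (fun g' hg'm hg'b hg'c => by simpa only [neg_neg, ENNReal.ofReal_ofNat] using hL2 g' hg'm hg'b hg'c)
      hgm hC hgc
    simpa only [ENNReal.ofReal_ofNat] using h
  have hHn : ∀ y : E, ∫⁻ x in {x | 2 * ‖y‖ ≤ ‖x‖}, ‖k (-(x - y)) - k (-x)‖ₑ ∂μ ≤ B := hormander_neg hH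
  -- case analysis on `p` versus `2`
  rcases lt_trichotomy p 2 with hlt | heq | hgt
  · -- `1 < p < 2`
    have h := eLpNorm_le_of_lt_two (μ := μ) hk hM hL2 hH hp1 hlt hf ⟨Cf, hCf⟩ hfc
    refine h.trans ?_
    gcongr
    calc _ = K pr := by simp only [hK, hA₁, hpr]
      _ ≤ K pr + K qr + A := by rw [add_assoc]; exact le_self_add
  · -- `p = 2`
    subst heq
    refine (hL2 f hf ⟨Cf, hCf⟩ hfc).trans ?_
    gcongr
    exact le_add_self
  · -- `2 < p < ∞`: the reflected kernel on `L^{p'}`, then duality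
    have hqr1 : 1 < qr := hpq.symm.lt
    have hqr2 : ENNReal.ofReal qr < 2 := by
      rw [← ENNReal.ofReal_ofNat 2]
      refine (ENNReal.ofReal_lt_ofReal_iff (by norm_num)).2 ?_
      have hpr2 : 2 < pr := by
        rw [hpr, ← ENNReal.toReal_ofNat 2]
        exact (ENNReal.toReal_lt_toReal ENNReal.ofNat_ne_top hp_top).2 hgt
      rw [hqr, div_lt_iff₀ (by linarith)]
      linarith
    have hqr1' : 1 < ENNReal.ofReal qr := by
      rw [← ENNReal.ofReal_one]; exact (ENNReal.ofReal_lt_ofReal_iff hqr0).2 hqr1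
    -- the `L^{qr}` bound for the reflected kernel on the admissible class
    have hadj : ∀ g : E → ℝ, Measurable g → (∃ C, ∀ x, |g x| ≤ C) → HasCompactSupport g →
        eLpNorm (fun t => ∫ x, g x * k (-(t - x)) ∂μ) (ENNReal.ofReal qr) μ ≤ K qr * eLpNorm g (ENNReal.ofReal qr) μ := by
      intro g hgm hgb hgc
      have h := eLpNorm_le_of_lt_two (μ := μ) (k := fun z => k (-z)) hkn hMn hL2n hHn hqr1' hqr2 hgm hgb hgc
      refine h.trans (le_of_eq ?_)
      congr 1
      simp only [hK, hA₁, ENNReal.toReal_ofReal hqr0.le]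
    have h := eLpNorm_le_of_adjoint (μ := μ) hk hM hpq hadj hf hCf hfc
    have hpp : ENNReal.ofReal pr = p := by rw [hpr, ENNReal.ofReal_toReal hp_top]
    rw [hpp] at h
    refine h.trans ?_
    gcongr
    calc K qr ≤ K pr + K qr := le_add_self
      _ ≤ K pr + K qr + A := le_self_add

end Literature.Analysis.SingularIntegrals
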